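/-
Copyright (c) 2026. All rights reserved.
Released under Apache 2.0 license as described in the file LICENSE.
-/
import Literature.Probability.FitznerVanDerHofstad2017.SrwTwistWeightClasses
import HarnessLib

/-!
# Enclosures of the `K_{n,2}`, `U_{n,0}`, `U_{n,2}`, `KM₂` twisted moments from PURE cosine-product classes

Support module (d-generic, number-free, definition-free).  The trigonometric-majorant rows of the
KU-SEP chain (`SrwTrigMajorantEncl`: `srwK_le_encl_of_trigMajorant`, `srwU_le_encl_of_trigMajorant`,
`srwKM2_le_encl_of_trigMajorant`) consume two-sided enclosures `lo ≤ Tw^{w}_n(x;β) ≤ hi` of the twisted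
moments of the row weights `w ∈ {|D̂|², |D̂|⁰ D̂^{sin}, |D̂|² D̂^{sin}, |D̂|⁰ M̂²}`.  By the class identities of
`SrwTwistWeightClasses` these moments are FIXED signed rational combinations of twisted moments of
PURE COSINE PRODUCTS `Π_μ cos^{a_μ} k_μ` (the objects the product-kernel certificates and the plain-seed
masses speak about).  This file performs the bookkeeping once, for general `d`:

* `srwTwist_abs_Dhat_sq_encl` — `Tw^{|D̂|²}_n` from enclosures of the classes `[2] = cos² k_i` and
  `[1,1] = cos k_i cos k_{i'}`;
* `srwTwist_abs_Dhat_pow_zero_mul_Dsin_encl` — `Tw^{|D̂|⁰ D̂^{sin}}_n` from `[0] = 1` and `[2]`;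
* `srwTwist_abs_Dhat_sq_mul_Dsin_eq_pure` / `srwTwist_abs_Dhat_sq_mul_Dsin_encl` — `Tw^{|D̂|² D̂^{sin}}_n`
  in / from the classes `[2]`, `[4]`, `[2,2]`, `[1,1]`, `[3,1]`, `[1,1,2]`;
* `srwTwist_abs_Dhat_pow_zero_mul_Mhat_sq_eq_pure` / `srwTwist_abs_Dhat_pow_zero_mul_Mhat_sq_encl` —
  `Tw^{|D̂|⁰ M̂²}_n` in / from `[2]ₙ, [1,1]ₙ, [1]ₙ₊₁, [3]ₙ₊₁, [1,2]ₙ₊₁, [0]ₙ₊₂, [2]ₙ₊₂, [4]ₙ₊₂, [2,2]ₙ₊₂`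
  (the `Ĉ` in `M̂ = D̂ − 2 D̂^{sin} Ĉ` shifts the Schwinger order);
* `uniform_encl_of_abs_sub_mul_le` — the enclosure delivered by an `m`-uniform estimate
  `|T − Q·m| ≤ E` with `0 ≤ Q`, `mlo ≤ m ≤ mhi`;
* `prod_cos_pow_single_add_single_add_single`, `srwTwist_prodCosPow_single_add_single_add_single` — the
  three-index bridge to the exponent-vector form of the product kernels (class `[1,1,2]`).

All statements are exact identities / monotone bookkeeping for general `d`; nothing here is numerical and
nothing is a certificate.  No dimension-specific declaration is introduced.

References (page and equation numbers refer to the NoBLE companion): [NoBLE17-I] R. Fitzner,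
R. van der Hofstad, *Generalized approach to the non-backtracking lace expansion*, Probab. Theory
Relat. Fields 169 (2017) 1041–1119 (bib key `FitznerVanDerHofstad2016NoBLE`), §3.3.3 p. 1070,
(3.34)–(3.38) p. 1071, §5.2 (5.9), (5.14) p. 1092; applied in [FvdH17] R. Fitzner, R. van der Hofstad,
*Mean-field behavior for nearest-neighbor percolation in `d > 10`*, Electron. J. Probab. 22 (2017) no. 43.
-/

namespace Literature.Probability.FitznerVanDerHofstad2017

open MeasureTheory Real Finset
open Literature.Barriers.CriticalPhenomena
open Literature.Barriers.CriticalPhenomena.Slade2006Prop53 (P)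

variable {d : ℕ}

/-! ### Generic enclosure bookkeeping -/

/-- The enclosure delivered by an `m`-uniform estimate: `|T − Q m| ≤ E`, `0 ≤ Q`, `mlo ≤ m ≤ mhi` give
`Q mlo − E ≤ T ≤ Q mhi + E`. [folklore] bookkeeping for [cite: FitznerVanDerHofstad2016NoBLE, §5.2 (5.9) p. 1092] -/
theorem uniform_encl_of_abs_sub_mul_le {T Q m E mlo mhi : ℝ} (h : |T - Q * m| ≤ E) (hQ : 0 ≤ Q)
    (hlo : mlo ≤ m) (hhi : m ≤ mhi) : Q * mlo - E ≤ T ∧ T ≤ Q * mhi + E := by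
  obtain ⟨h₁, h₂⟩ := abs_le.mp h
  have hl := mul_le_mul_of_nonneg_left hlo hQ
  have hh := mul_le_mul_of_nonneg_left hhi hQ
  constructor <;> linarith

/-- `1 ≤ d` and the sign facts `0 ≤ 1/d`, `0 ≤ d − 1` used by the monotone bookkeeping. [folklore] -/
private theorem coeff_nonneg (hd : 1 ≤ d) : (0 : ℝ) ≤ 1 / d ∧ (0 : ℝ) ≤ (d : ℝ) - 1 := by
  have h1 : (1 : ℝ) ≤ d := by exact_mod_cast hd
  exact ⟨by positivity, by linarith⟩

/-! ### `K_{n,2}`: the weight `|D̂|²` -/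

/-- **`Tw^{|D̂|²}_n(x;β)` from the classes `[2]`, `[1,1]`** (`i ≠ i'`, `d ≥ 2n+1`):
`d⁻¹ l₂ + ((d−1)/d) l₁₁ ≤ Tw^{|D̂|²}_n(x;β) ≤ d⁻¹ h₂ + ((d−1)/d) h₁₁`.
[cite: FitznerVanDerHofstad2016NoBLE, (3.36) p. 1071, §5.2 (5.9) p. 1092] -/
theorem srwTwist_abs_Dhat_sq_encl {n : ℕ} (hd : 2 * n + 1 ≤ d) {i i' : Fin d} (hii' : i ≠ i')
    (x : Fin d → ℤ) (β : ℝ) {l₂ h₂ l₁₁ h₁₁ : ℝ}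
    (h2 : l₂ ≤ srwTwist d n (fun k => Real.cos (k i) ^ 2) x β
      ∧ srwTwist d n (fun k => Real.cos (k i) ^ 2) x β ≤ h₂)
    (h11 : l₁₁ ≤ srwTwist d n (fun k => Real.cos (k i) * Real.cos (k i')) x β
      ∧ srwTwist d n (fun k => Real.cos (k i) * Real.cos (k i')) x β ≤ h₁₁) :
    1 / d * l₂ + ((d : ℝ) - 1) / d * l₁₁ ≤ srwTwist d n (fun k => |Dhat d k| ^ 2) x β
      ∧ srwTwist d n (fun k => |Dhat d k| ^ 2) x β ≤ 1 / d * h₂ + ((d : ℝ) - 1) / d * h₁₁ := by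
  obtain ⟨hc0, hc1⟩ := coeff_nonneg (d := d) (by omega)
  have hc2 : (0 : ℝ) ≤ ((d : ℝ) - 1) / d := div_nonneg hc1 (Nat.cast_nonneg _)
  obtain ⟨h2l, h2h⟩ := h2
  obtain ⟨h11l, h11h⟩ := h11
  rw [srwTwist_abs_Dhat_sq_eq_classes hd hii' x β]
  constructor <;> gcongr

/-! ### `U_{n,0}`: the weight `|D̂|⁰ D̂^{sin}` -/

/-- **`Tw^{|D̂|⁰ D̂^{sin}}_n(x;β)` from the classes `[0]`, `[2]`** (`d ≥ 2n+1`):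
`d⁻¹ (l₀ − h₂) ≤ Tw^{|D̂|⁰ D̂^{sin}}_n(x;β) ≤ d⁻¹ (h₀ − l₂)`.
[cite: FitznerVanDerHofstad2016NoBLE, (3.38) p. 1071, §5.2 (5.14) p. 1092] -/
theorem srwTwist_abs_Dhat_pow_zero_mul_Dsin_encl {n : ℕ} (hd : 2 * n + 1 ≤ d) (i : Fin d)
    (x : Fin d → ℤ) (β : ℝ) {l₀ h₀ l₂ h₂ : ℝ}
    (h0 : l₀ ≤ srwTwist d n (fun _ => (1 : ℝ)) x β ∧ srwTwist d n (fun _ => (1 : ℝ)) x β ≤ h₀)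
    (h2 : l₂ ≤ srwTwist d n (fun k => Real.cos (k i) ^ 2) x β
      ∧ srwTwist d n (fun k => Real.cos (k i) ^ 2) x β ≤ h₂) :
    1 / d * (l₀ - h₂) ≤ srwTwist d n (fun k => |Dhat d k| ^ 0 * Dsin d k) x β
      ∧ srwTwist d n (fun k => |Dhat d k| ^ 0 * Dsin d k) x β ≤ 1 / d * (h₀ - l₂) := by
  obtain ⟨hc0, -⟩ := coeff_nonneg (d := d) (by omega)
  obtain ⟨h0l, h0h⟩ := h0
  obtain ⟨h2l, h2h⟩ := h2
  rw [srwTwist_abs_Dhat_pow_zero_mul_Dsin_eq hd i x β]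
  constructor <;> gcongr

/-! ### Three-index bridge to the exponent-vector form -/

/-- `Π_μ cos(k_μ)^{(a e_i + b e_j + c e_l)_μ} = cos(k_i)^a · cos(k_j)^b · cos(k_l)^c` (any indices; for
coinciding indices both sides merge powers). [cite: FitznerVanDerHofstad2016NoBLE, (3.34) p. 1071] -/
theorem prod_cos_pow_single_add_single_add_single (i j l : Fin d) (a b c : ℕ) (k : Fin d → ℝ) :
    ∏ μ, Real.cos (k μ) ^ (Pi.single i a + Pi.single j b + Pi.single l c : Fin d → ℕ) μ
      = Real.cos (k i) ^ a * Real.cos (k j) ^ b * Real.cos (k l) ^ c := by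
  have h : (fun μ => Real.cos (k μ) ^ (Pi.single i a + Pi.single j b + Pi.single l c : Fin d → ℕ) μ)
      = fun μ => Real.cos (k μ) ^ (Pi.single i a + Pi.single j b : Fin d → ℕ) μ
          * Real.cos (k μ) ^ (Pi.single l c : Fin d → ℕ) μ := by
    funext μ
    rw [Pi.add_apply, pow_add]
  rw [h, Finset.prod_mul_distrib, prod_cos_pow_single_add_single i j a b k, prod_cos_pow_single l c k]

/-- `Tw^{Π cos^{a e_i + b e_j + c e_l}}_n(x;β) = Tw^{cos^a k_i cos^b k_j cos^c k_l}_n(x;β)`: the three-index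
bridge between the exponent-vector form of the product kernels and the class weights.
[cite: FitznerVanDerHofstad2016NoBLE, (3.34) p. 1071] -/
theorem srwTwist_prodCosPow_single_add_single_add_single (n : ℕ) (i j l : Fin d) (a b c : ℕ)
    (x : Fin d → ℤ) (β : ℝ) :
    srwTwist d n (fun k => ∏ μ, Real.cos (k μ) ^ (Pi.single i a + Pi.single j b + Pi.single l c
        : Fin d → ℕ) μ) x β
      = srwTwist d n (fun k => Real.cos (k i) ^ a * Real.cos (k j) ^ b * Real.cos (k l) ^ c) x β := by
  congr 1
  funext k
  exact prod_cos_pow_single_add_single_add_single i j l a b c k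

/-! ### Transport helpers (canonical class representatives) -/

/-- `Tw^{cos² k_j}_n = Tw^{cos² k_i}_n` (coordinate symmetry). [folklore] -/
private theorem tw_cos_sq_transport (n : ℕ) (i j : Fin d) (x : Fin d → ℤ) (β : ℝ) :
    srwTwist d n (fun k => Real.cos (k j) ^ 2) x β = srwTwist d n (fun k => Real.cos (k i) ^ 2) x β := by
  have h := srwTwist_transport₁' (n := n) (fun _ : (Fin d → ℝ) => (1 : ℝ)) (fun t => Real.cos t ^ 2)
    (fun _ _ => rfl) i j x β
  simpa only [one_mul] using h

/-- `Tw^{cos k_j cos k_{j'}}_n = Tw^{cos k_i cos k_{i'}}_n` (`i ≠ i'`, `j ≠ j'`). [folklore] -/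
private theorem tw_cos_cos_transport (n : ℕ) {i i' j j' : Fin d} (hii' : i ≠ i') (hjj' : j ≠ j')
    (x : Fin d → ℤ) (β : ℝ) :
    srwTwist d n (fun k => Real.cos (k j) * Real.cos (k j')) x β
      = srwTwist d n (fun k => Real.cos (k i) * Real.cos (k i')) x β := by
  have h := srwTwist_transport₂' (n := n) (fun _ : (Fin d → ℝ) => (1 : ℝ)) Real.cos Real.cos
    (fun _ _ => rfl) hii' hjj' x β
  simpa only [one_mul] using h

/-- Measurability of `k ↦ cos(k_i)^a`. [folklore] -/
private theorem measurable_cos_pow (i : Fin d) (a : ℕ) :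
    Measurable fun k : Fin d → ℝ => Real.cos (k i) ^ a :=
  (Real.continuous_cos.measurable.comp (measurable_pi_apply i)).pow_const a

/-- `|cos(k_i)^a| ≤ 1`. [folklore] -/
private theorem abs_cos_pow_le_one (i : Fin d) (a : ℕ) (k : Fin d → ℝ) : |Real.cos (k i) ^ a| ≤ 1 := by
  rw [abs_pow]
  exact pow_le_one₀ (abs_nonneg _) (Real.abs_cos_le_one _)

/-- Measurability of `k ↦ cos k_i cos k_{i'}`. [folklore] -/
private theorem measurable_cos_mul_cos (i i' : Fin d) :
    Measurable fun k : Fin d → ℝ => Real.cos (k i) * Real.cos (k i') :=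
  (Real.continuous_cos.measurable.comp (measurable_pi_apply i)).mul
    (Real.continuous_cos.measurable.comp (measurable_pi_apply i'))

/-- `|cos k_i cos k_{i'}| ≤ 1`. [folklore] -/
private theorem abs_cos_mul_cos_le_one (i i' : Fin d) (k : Fin d → ℝ) :
    |Real.cos (k i) * Real.cos (k i')| ≤ 1 := by
  rw [abs_mul]
  exact mul_le_one₀ (Real.abs_cos_le_one _) (abs_nonneg _) (Real.abs_cos_le_one _)

/-- From two distinct indices, `2 ≤ d` (as a real inequality `0 ≤ d − 2`). [folklore] -/
private theorem two_le_of_ne {i i' : Fin d} (hii' : i ≠ i') : (0 : ℝ) ≤ (d : ℝ) - 2 := by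
  have h1 : 1 < Fintype.card (Fin d) := Fintype.one_lt_card_iff_nontrivial.mpr ⟨⟨i, i', hii'⟩⟩
  rw [Fintype.card_fin] at h1
  have h2 : 2 ≤ d := h1
  have : (2 : ℝ) ≤ d := by exact_mod_cast h2
  linarith

/-! ### `U_{n,2}`: the weight `|D̂|² D̂^{sin}` in pure classes -/

/-- **`Tw^{|D̂|² D̂^{sin}}_n(x;β)` in PURE cosine-product classes** (`i₀, i, i'` pairwise distinct,
`d ≥ 2n+1`): with `P₂ = Tw^{cos² k_{i₀}}`, `P₄ = Tw^{cos⁴ k_{i₀}}`, `P₁₁ = Tw^{cos k_{i₀} cos k_i}`,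
`P₂₂ = Tw^{cos² k_{i₀} cos² k_i}`, `P₃₁ = Tw^{cos³ k_{i₀} cos k_i}`, `P₁₁₂ = Tw^{cos k_i cos k_{i'} cos² k_{i₀}}`
(all at order `n`, node `x`, twist `β`),
`Tw^{|D̂|² D̂^{sin}}_n = d⁻¹ (d⁻²((P₂ − P₄) + (d−1)(P₂ − P₂₂) + 2(d−1)(P₁₁ − P₃₁) + (d−1)(d−2)(P₁₁ − P₁₁₂)))`.
[cite: FitznerVanDerHofstad2016NoBLE, (3.35)–(3.38) p. 1071] -/
theorem srwTwist_abs_Dhat_sq_mul_Dsin_eq_pure {n : ℕ} (hd : 2 * n + 1 ≤ d) {i₀ i i' : Fin d}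
    (hi : i ≠ i₀) (hi' : i' ≠ i₀) (hii' : i ≠ i') (x : Fin d → ℤ) (β : ℝ) :
    srwTwist d n (fun k => |Dhat d k| ^ 2 * Dsin d k) x β
      = 1 / d * ((1 / (d : ℝ)) ^ 2
          * ((srwTwist d n (fun k => Real.cos (k i₀) ^ 2) x β
                - srwTwist d n (fun k => Real.cos (k i₀) ^ 4) x β)
            + ((d : ℝ) - 1) * (srwTwist d n (fun k => Real.cos (k i₀) ^ 2) x β
                - srwTwist d n (fun k => Real.cos (k i₀) ^ 2 * Real.cos (k i) ^ 2) x β)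
            + 2 * ((d : ℝ) - 1) * (srwTwist d n (fun k => Real.cos (k i₀) * Real.cos (k i)) x β
                - srwTwist d n (fun k => Real.cos (k i₀) ^ 3 * Real.cos (k i)) x β)
            + ((d : ℝ) - 1) * ((d : ℝ) - 2)
                * (srwTwist d n (fun k => Real.cos (k i₀) * Real.cos (k i)) x β
                  - srwTwist d n (fun k => Real.cos (k i) * Real.cos (k i') * Real.cos (k i₀) ^ 2) x β))) := by
  rw [srwTwist_abs_Dhat_sq_mul_Dsin_eq_marked hd hi hi' hii' x β]
  -- A: sin² cos² at i₀
  have hA : srwTwist d n (fun k => Real.sin (k i₀) ^ 2 * Real.cos (k i₀) ^ 2) x β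
      = srwTwist d n (fun k => Real.cos (k i₀) ^ 2) x β
          - srwTwist d n (fun k => Real.cos (k i₀) ^ 4) x β := by
    have h := srwTwist_mul_sin_sq_eq_sub hd (fun k => Real.cos (k i₀) ^ 2) (measurable_cos_pow i₀ 2)
      (abs_cos_pow_le_one i₀ 2) i₀ x β
    rw [show (fun k : Fin d → ℝ => Real.sin (k i₀) ^ 2 * Real.cos (k i₀) ^ 2)
        = fun k => Real.cos (k i₀) ^ 2 * Real.sin (k i₀) ^ 2 from funext fun k => mul_comm _ _, h,
      show (fun k : Fin d → ℝ => Real.cos (k i₀) ^ 2 * Real.cos (k i₀) ^ 2)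
        = fun k => Real.cos (k i₀) ^ 4 from funext fun k => by ring]
  -- B: sin²_{i₀} cos²_i
  have hB : srwTwist d n (fun k => Real.sin (k i₀) ^ 2 * Real.cos (k i) ^ 2) x β
      = srwTwist d n (fun k => Real.cos (k i₀) ^ 2) x β
          - srwTwist d n (fun k => Real.cos (k i₀) ^ 2 * Real.cos (k i) ^ 2) x β := by
    have h := srwTwist_mul_sin_sq_eq_sub hd (fun k => Real.cos (k i) ^ 2) (measurable_cos_pow i 2)
      (abs_cos_pow_le_one i 2) i₀ x β
    rw [show (fun k : Fin d → ℝ => Real.sin (k i₀) ^ 2 * Real.cos (k i) ^ 2)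
        = fun k => Real.cos (k i) ^ 2 * Real.sin (k i₀) ^ 2 from funext fun k => mul_comm _ _, h,
      tw_cos_sq_transport n i₀ i x β,
      show (fun k : Fin d → ℝ => Real.cos (k i) ^ 2 * Real.cos (k i₀) ^ 2)
        = fun k => Real.cos (k i₀) ^ 2 * Real.cos (k i) ^ 2 from funext fun k => mul_comm _ _]
  -- C: sin²_{i₀} (cos_{i₀} cos_i)
  have hC : srwTwist d n (fun k => Real.sin (k i₀) ^ 2 * (Real.cos (k i₀) * Real.cos (k i))) x β
      = srwTwist d n (fun k => Real.cos (k i₀) * Real.cos (k i)) x β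
          - srwTwist d n (fun k => Real.cos (k i₀) ^ 3 * Real.cos (k i)) x β := by
    have h := srwTwist_mul_sin_sq_eq_sub hd (fun k => Real.cos (k i₀) * Real.cos (k i))
      (measurable_cos_mul_cos i₀ i) (abs_cos_mul_cos_le_one i₀ i) i₀ x β
    rw [show (fun k : Fin d → ℝ => Real.sin (k i₀) ^ 2 * (Real.cos (k i₀) * Real.cos (k i)))
        = fun k => Real.cos (k i₀) * Real.cos (k i) * Real.sin (k i₀) ^ 2 from
          funext fun k => mul_comm _ _, h,
      show (fun k : Fin d → ℝ => Real.cos (k i₀) * Real.cos (k i) * Real.cos (k i₀) ^ 2)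
        = fun k => Real.cos (k i₀) ^ 3 * Real.cos (k i) from funext fun k => by ring]
  -- D: sin²_{i₀} (cos_i cos_i')
  have hD : srwTwist d n (fun k => Real.sin (k i₀) ^ 2 * (Real.cos (k i) * Real.cos (k i'))) x β
      = srwTwist d n (fun k => Real.cos (k i₀) * Real.cos (k i)) x β
          - srwTwist d n (fun k => Real.cos (k i) * Real.cos (k i') * Real.cos (k i₀) ^ 2) x β := by
    have h := srwTwist_mul_sin_sq_eq_sub hd (fun k => Real.cos (k i) * Real.cos (k i'))
      (measurable_cos_mul_cos i i') (abs_cos_mul_cos_le_one i i') i₀ x β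
    rw [show (fun k : Fin d → ℝ => Real.sin (k i₀) ^ 2 * (Real.cos (k i) * Real.cos (k i')))
        = fun k => Real.cos (k i) * Real.cos (k i') * Real.sin (k i₀) ^ 2 from
          funext fun k => mul_comm _ _, h,
      tw_cos_cos_transport n hi.symm hii' x β]
  rw [hA, hB, hC, hD]

/-- **Enclosure of `Tw^{|D̂|² D̂^{sin}}_n(x;β)` from enclosures of the pure classes `[2]`, `[4]`, `[1,1]`,
`[2,2]`, `[3,1]`, `[1,1,2]`** (same representatives as `srwTwist_abs_Dhat_sq_mul_Dsin_eq_pure`):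
lower / upper bound = the identity with each difference `P − P'` replaced by `lo − hi'` / `hi − lo'`.
[cite: FitznerVanDerHofstad2016NoBLE, (3.38) p. 1071, §5.2 (5.14) p. 1092] -/
theorem srwTwist_abs_Dhat_sq_mul_Dsin_encl {n : ℕ} (hd : 2 * n + 1 ≤ d) {i₀ i i' : Fin d}
    (hi : i ≠ i₀) (hi' : i' ≠ i₀) (hii' : i ≠ i') (x : Fin d → ℤ) (β : ℝ)
    {l₂ h₂ l₄ h₄ l₁₁ h₁₁ l₂₂ h₂₂ l₃₁ h₃₁ l₁₁₂ h₁₁₂ : ℝ}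
    (e2 : l₂ ≤ srwTwist d n (fun k => Real.cos (k i₀) ^ 2) x β
      ∧ srwTwist d n (fun k => Real.cos (k i₀) ^ 2) x β ≤ h₂)
    (e4 : l₄ ≤ srwTwist d n (fun k => Real.cos (k i₀) ^ 4) x β
      ∧ srwTwist d n (fun k => Real.cos (k i₀) ^ 4) x β ≤ h₄)
    (e11 : l₁₁ ≤ srwTwist d n (fun k => Real.cos (k i₀) * Real.cos (k i)) x β
      ∧ srwTwist d n (fun k => Real.cos (k i₀) * Real.cos (k i)) x β ≤ h₁₁)
    (e22 : l₂₂ ≤ srwTwist d n (fun k => Real.cos (k i₀) ^ 2 * Real.cos (k i) ^ 2) x β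
      ∧ srwTwist d n (fun k => Real.cos (k i₀) ^ 2 * Real.cos (k i) ^ 2) x β ≤ h₂₂)
    (e31 : l₃₁ ≤ srwTwist d n (fun k => Real.cos (k i₀) ^ 3 * Real.cos (k i)) x β
      ∧ srwTwist d n (fun k => Real.cos (k i₀) ^ 3 * Real.cos (k i)) x β ≤ h₃₁)
    (e112 : l₁₁₂ ≤ srwTwist d n (fun k => Real.cos (k i) * Real.cos (k i') * Real.cos (k i₀) ^ 2) x β
      ∧ srwTwist d n (fun k => Real.cos (k i) * Real.cos (k i') * Real.cos (k i₀) ^ 2) x β ≤ h₁₁₂) :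
    1 / d * ((1 / (d : ℝ)) ^ 2 * ((l₂ - h₄) + ((d : ℝ) - 1) * (l₂ - h₂₂)
        + 2 * ((d : ℝ) - 1) * (l₁₁ - h₃₁) + ((d : ℝ) - 1) * ((d : ℝ) - 2) * (l₁₁ - h₁₁₂)))
      ≤ srwTwist d n (fun k => |Dhat d k| ^ 2 * Dsin d k) x β
    ∧ srwTwist d n (fun k => |Dhat d k| ^ 2 * Dsin d k) x β
      ≤ 1 / d * ((1 / (d : ℝ)) ^ 2 * ((h₂ - l₄) + ((d : ℝ) - 1) * (h₂ - l₂₂)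
        + 2 * ((d : ℝ) - 1) * (h₁₁ - l₃₁) + ((d : ℝ) - 1) * ((d : ℝ) - 2) * (h₁₁ - l₁₁₂))) := by
  obtain ⟨hc0, hc1⟩ := coeff_nonneg (d := d) (by omega)
  have hc2 : (0 : ℝ) ≤ (d : ℝ) - 2 := two_le_of_ne hii'
  have hc3 : (0 : ℝ) ≤ 2 * ((d : ℝ) - 1) := by positivity
  have hc4 : (0 : ℝ) ≤ ((d : ℝ) - 1) * ((d : ℝ) - 2) := mul_nonneg hc1 hc2
  obtain ⟨e2l, e2h⟩ := e2; obtain ⟨e4l, e4h⟩ := e4; obtain ⟨e11l, e11h⟩ := e11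
  obtain ⟨e22l, e22h⟩ := e22; obtain ⟨e31l, e31h⟩ := e31; obtain ⟨e112l, e112h⟩ := e112
  rw [srwTwist_abs_Dhat_sq_mul_Dsin_eq_pure hd hi hi' hii' x β]
  constructor <;> gcongr

/-! ### `KM₂`: the weight `|D̂|⁰ M̂²` in pure classes -/

/-- **`Tw^{|D̂|⁰ M̂²}_n(x;β)` in PURE cosine-product classes** (`i ≠ i'`, `d ≥ 2(n+2)+1`): with
`P_a^{(m)} = Tw^{cos^a k_i}_m`, `P₁₁^{(m)} = Tw^{cos k_i cos k_{i'}}_m`, `P₁₂^{(m)} = Tw^{cos k_i cos² k_{i'}}_m`,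
`P₂₂^{(m)} = Tw^{cos² k_i cos² k_{i'}}_m`, `P₀^{(m)} = Tw^{1}_m`,
`Tw^{|D̂|⁰ M̂²}_n = (d⁻¹ P₂^{(n)} + ((d−1)/d) P₁₁^{(n)}) − 4 d⁻² ((P₁ − P₃) + (d−1)(P₁ − P₁₂))^{(n+1)}
  + 4 d⁻³ (((P₀ − P₂) − (P₂ − P₄)) + (d−1)((P₀ − P₂) − (P₂ − P₂₂)))^{(n+2)}`.
[cite: FitznerVanDerHofstad2016NoBLE, (3.36)–(3.38) p. 1071] -/
theorem srwTwist_abs_Dhat_pow_zero_mul_Mhat_sq_eq_pure {n : ℕ} (hd : 2 * (n + 2) + 1 ≤ d)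
    {i i' : Fin d} (hii' : i ≠ i') (x : Fin d → ℤ) (β : ℝ) :
    srwTwist d n (fun k => |Dhat d k| ^ 0 * Mhat d k ^ 2) x β
      = (1 / d * srwTwist d n (fun k => Real.cos (k i) ^ 2) x β
          + ((d : ℝ) - 1) / d * srwTwist d n (fun k => Real.cos (k i) * Real.cos (k i')) x β)
        - 4 * ((1 / (d : ℝ)) ^ 2
          * ((srwTwist d (n + 1) (fun k => Real.cos (k i)) x β
                - srwTwist d (n + 1) (fun k => Real.cos (k i) ^ 3) x β)
            + ((d : ℝ) - 1) * (srwTwist d (n + 1) (fun k => Real.cos (k i)) x β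
                - srwTwist d (n + 1) (fun k => Real.cos (k i) * Real.cos (k i') ^ 2) x β)))
        + 4 * ((1 / (d : ℝ)) ^ 3
          * (((srwTwist d (n + 2) (fun _ => (1 : ℝ)) x β
                  - srwTwist d (n + 2) (fun k => Real.cos (k i) ^ 2) x β)
                - (srwTwist d (n + 2) (fun k => Real.cos (k i) ^ 2) x β
                  - srwTwist d (n + 2) (fun k => Real.cos (k i) ^ 4) x β))
            + ((d : ℝ) - 1) * ((srwTwist d (n + 2) (fun _ => (1 : ℝ)) x β
                  - srwTwist d (n + 2) (fun k => Real.cos (k i) ^ 2) x β)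
                - (srwTwist d (n + 2) (fun k => Real.cos (k i) ^ 2) x β
                  - srwTwist d (n + 2) (fun k => Real.cos (k i) ^ 2 * Real.cos (k i') ^ 2) x β)))) := by
  rw [srwTwist_abs_Dhat_pow_zero_mul_Mhat_sq_eq_classes hd hii' x β]
  have hd1 : 2 * (n + 1) + 1 ≤ d := by omega
  have hd2 : 2 * (n + 2) + 1 ≤ d := hd
  -- order n+1: cos_i sin²_i and cos_i sin²_{i'}
  have hA : srwTwist d (n + 1) (fun k => Real.cos (k i) * Real.sin (k i) ^ 2) x β
      = srwTwist d (n + 1) (fun k => Real.cos (k i)) x β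
          - srwTwist d (n + 1) (fun k => Real.cos (k i) ^ 3) x β := by
    rw [srwTwist_cos_mul_sin_sq_eq_sub hd1 i i x β,
      show (fun k : Fin d → ℝ => Real.cos (k i) * Real.cos (k i) ^ 2) = fun k => Real.cos (k i) ^ 3 from
        funext fun k => by ring]
  have hB : srwTwist d (n + 1) (fun k => Real.cos (k i) * Real.sin (k i') ^ 2) x β
      = srwTwist d (n + 1) (fun k => Real.cos (k i)) x β
          - srwTwist d (n + 1) (fun k => Real.cos (k i) * Real.cos (k i') ^ 2) x β :=
    srwTwist_cos_mul_sin_sq_eq_sub hd1 i i' x β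
  -- order n+2: sin⁴_i and sin²_i sin²_{i'}
  have hC : srwTwist d (n + 2) (fun k => Real.sin (k i) ^ 4) x β
      = (srwTwist d (n + 2) (fun _ => (1 : ℝ)) x β - srwTwist d (n + 2) (fun k => Real.cos (k i) ^ 2) x β)
        - (srwTwist d (n + 2) (fun k => Real.cos (k i) ^ 2) x β
          - srwTwist d (n + 2) (fun k => Real.cos (k i) ^ 4) x β) := by
    rw [srwTwist_sin_pow_four_eq (n + 2) i x β, srwTwist_sin_sq_mul_sin_sq_eq hd2 i i x β,
      show (fun k : Fin d → ℝ => Real.cos (k i) ^ 2 * Real.cos (k i) ^ 2) = fun k => Real.cos (k i) ^ 4 from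
        funext fun k => by ring]
  have hD : srwTwist d (n + 2) (fun k => Real.sin (k i) ^ 2 * Real.sin (k i') ^ 2) x β
      = (srwTwist d (n + 2) (fun _ => (1 : ℝ)) x β - srwTwist d (n + 2) (fun k => Real.cos (k i) ^ 2) x β)
        - (srwTwist d (n + 2) (fun k => Real.cos (k i) ^ 2) x β
          - srwTwist d (n + 2) (fun k => Real.cos (k i) ^ 2 * Real.cos (k i') ^ 2) x β) := by
    rw [srwTwist_sin_sq_mul_sin_sq_eq hd2 i i' x β, tw_cos_sq_transport (n + 2) i i' x β,
      show (fun k : Fin d → ℝ => Real.cos (k i') ^ 2 * Real.cos (k i) ^ 2)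
        = fun k => Real.cos (k i) ^ 2 * Real.cos (k i') ^ 2 from funext fun k => mul_comm _ _]
  rw [hA, hB, hC, hD]

/-- **Enclosure of `Tw^{|D̂|⁰ M̂²}_n(x;β)` from enclosures of the pure classes** `[2]ₙ, [1,1]ₙ, [1]ₙ₊₁,
[3]ₙ₊₁, [1,2]ₙ₊₁, [0]ₙ₊₂, [2]ₙ₊₂, [4]ₙ₊₂, [2,2]ₙ₊₂` (representatives as in
`srwTwist_abs_Dhat_pow_zero_mul_Mhat_sq_eq_pure`; `i ≠ i'`, `d ≥ 2(n+2)+1`): lower / upper bound = the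
identity with every difference replaced by the corresponding difference of bounds.
[cite: FitznerVanDerHofstad2016NoBLE, (3.36)–(3.38) p. 1071, §5.2 (5.9) p. 1092] -/
theorem srwTwist_abs_Dhat_pow_zero_mul_Mhat_sq_encl {n : ℕ} (hd : 2 * (n + 2) + 1 ≤ d)
    {i i' : Fin d} (hii' : i ≠ i') (x : Fin d → ℤ) (β : ℝ)
    {l₂ h₂ l₁₁ h₁₁ l₁ h₁ l₃ h₃ l₁₂ h₁₂ m₀ M₀ m₂ M₂ m₄ M₄ m₂₂ M₂₂ : ℝ}
    (e2 : l₂ ≤ srwTwist d n (fun k => Real.cos (k i) ^ 2) x β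
      ∧ srwTwist d n (fun k => Real.cos (k i) ^ 2) x β ≤ h₂)
    (e11 : l₁₁ ≤ srwTwist d n (fun k => Real.cos (k i) * Real.cos (k i')) x β
      ∧ srwTwist d n (fun k => Real.cos (k i) * Real.cos (k i')) x β ≤ h₁₁)
    (e1 : l₁ ≤ srwTwist d (n + 1) (fun k => Real.cos (k i)) x β
      ∧ srwTwist d (n + 1) (fun k => Real.cos (k i)) x β ≤ h₁)
    (e3 : l₃ ≤ srwTwist d (n + 1) (fun k => Real.cos (k i) ^ 3) x β
      ∧ srwTwist d (n + 1) (fun k => Real.cos (k i) ^ 3) x β ≤ h₃)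
    (e12 : l₁₂ ≤ srwTwist d (n + 1) (fun k => Real.cos (k i) * Real.cos (k i') ^ 2) x β
      ∧ srwTwist d (n + 1) (fun k => Real.cos (k i) * Real.cos (k i') ^ 2) x β ≤ h₁₂)
    (f0 : m₀ ≤ srwTwist d (n + 2) (fun _ => (1 : ℝ)) x β ∧ srwTwist d (n + 2) (fun _ => (1 : ℝ)) x β ≤ M₀)
    (f2 : m₂ ≤ srwTwist d (n + 2) (fun k => Real.cos (k i) ^ 2) x β
      ∧ srwTwist d (n + 2) (fun k => Real.cos (k i) ^ 2) x β ≤ M₂)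
    (f4 : m₄ ≤ srwTwist d (n + 2) (fun k => Real.cos (k i) ^ 4) x β
      ∧ srwTwist d (n + 2) (fun k => Real.cos (k i) ^ 4) x β ≤ M₄)
    (f22 : m₂₂ ≤ srwTwist d (n + 2) (fun k => Real.cos (k i) ^ 2 * Real.cos (k i') ^ 2) x β
      ∧ srwTwist d (n + 2) (fun k => Real.cos (k i) ^ 2 * Real.cos (k i') ^ 2) x β ≤ M₂₂) :
    (1 / d * l₂ + ((d : ℝ) - 1) / d * l₁₁)
        - 4 * ((1 / (d : ℝ)) ^ 2 * ((h₁ - l₃) + ((d : ℝ) - 1) * (h₁ - l₁₂)))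
        + 4 * ((1 / (d : ℝ)) ^ 3 * (((m₀ - M₂) - (M₂ - m₄)) + ((d : ℝ) - 1) * ((m₀ - M₂) - (M₂ - m₂₂))))
      ≤ srwTwist d n (fun k => |Dhat d k| ^ 0 * Mhat d k ^ 2) x β
    ∧ srwTwist d n (fun k => |Dhat d k| ^ 0 * Mhat d k ^ 2) x β
      ≤ (1 / d * h₂ + ((d : ℝ) - 1) / d * h₁₁)
        - 4 * ((1 / (d : ℝ)) ^ 2 * ((l₁ - h₃) + ((d : ℝ) - 1) * (l₁ - h₁₂)))
        + 4 * ((1 / (d : ℝ)) ^ 3 * (((M₀ - m₂) - (m₂ - M₄)) + ((d : ℝ) - 1) * ((M₀ - m₂) - (m₂ - M₂₂)))) := by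
  obtain ⟨hc0, hc1⟩ := coeff_nonneg (d := d) (by omega)
  have hc2 : (0 : ℝ) ≤ ((d : ℝ) - 1) / d := div_nonneg hc1 (Nat.cast_nonneg _)
  obtain ⟨e2l, e2h⟩ := e2; obtain ⟨e11l, e11h⟩ := e11; obtain ⟨e1l, e1h⟩ := e1
  obtain ⟨e3l, e3h⟩ := e3; obtain ⟨e12l, e12h⟩ := e12; obtain ⟨f0l, f0h⟩ := f0
  obtain ⟨f2l, f2h⟩ := f2; obtain ⟨f4l, f4h⟩ := f4; obtain ⟨f22l, f22h⟩ := f22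
  rw [srwTwist_abs_Dhat_pow_zero_mul_Mhat_sq_eq_pure hd hii' x β]
  constructor <;> gcongr

end Literature.Probability.FitznerVanDerHofstad2017
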